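import Literature.AlgebraicGeometry.ModuliOfAbelianVarieties.SiegelAdmissibleMarkingUniqueTorus
import Literature.AlgebraicGeometry.ModuliOfAbelianVarieties.SiegelPrincipalRepSameResidue
import Literature.AlgebraicGeometry.ModuliOfAbelianVarieties.SiegelPrincipalLevelSimilitudeTower
import Literature.AlgebraicGeometry.ModuliOfAbelianVarieties.SiegelAdelicMarkingPrincipalTransport
import Literature.AlgebraicGeometry.ModuliOfAbelianVarieties.SiegelAdelicMarkingOfAnalytification
import Literature.AlgebraicGeometry.ModuliOfAbelianVarieties.SiegelConjugationHomReindex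
import Literature.AlgebraicGeometry.AbelianSchemes.SymplecticLiftTwist
import Literature.NumberTheory.Adeles.IntegralAdeleResidue
import HarnessLib

/-!
# FLAT-d «PRINCIPAL CHANGE AT ONE FIBRE»: two admissible markings of one fibre at the same period point `Z` through two principal
# representatives of ONE residue have the same torus map ([Milne2005ShimuraVarieties] Thm. 6.11 + Lemma 5.13; [Deligne1971TravauxShimura] 4.12 (b), 4.16)

Topic `Literature/AlgebraicGeometry/ModuliOfAbelianVarieties`; namespace `Literature.AlgebraicGeometry.ModuliOfAbelianVarieties`.
THEOREMS ONLY (no definition, no named fact, no instance, no notation, no `sorry`).  Cell `hodgecm-mathlib` (D-0151), FLOOR 0, P6 «MOD»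
(crux hLiu418 = stmt-HodgeConjecture-24832, `--supports`), half A line L7 (socket `stub_UNIVFAM` = ★ P-3 `siegelUniversalFamilyUniformisation`
→ in-house), sub-organ **FLAT-d** of `stub_FLAT` (LA7-plan (g0) 02:42:53Z «adapter gap»: ★ NORM₀ `exists_normalisedChart` is applied once, with
the ADM-NF marking for ONE principal representative `(u₀, r₀)`; ★ FLAT-c `exists_framePackage_of_readings` must be fed the `t₀`-package for EVERY
`(u, r)` with the SAME chart junction — so the ADM-NF markings for `r₀` and `r` must have the SAME torus map).  Sequel of ★ MRK-UNIQ
`SiegelAdmissibleMarkingUniqueTorus` (one index).  HC_CM is proved only modulo the printed citations (2 remaining named inputs hLiu418 24832,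
h413 24833) until rung 0 closes; this file is generic and changes no count.

THE MATHEMATICS.  `r₀ = diag(1, u₀·1)`, `r = diag(1, u·1)` two principal representatives of one residue `c ∈ (ℤ∕N)ˣ`; then
`k := r₀⁻¹ r ∈ K_δ(N)` (★ `inv_mul_mem_principalLevelSubgroup_of_principalRep`).  Let `(m, Θ, Λ)` be matched at `(Z, r₀)` and `(m′, Θ′, Λ′)` at
`(Z, r)`, both with `γ = 1`.  RE-INDEX `m` to `r` with the same data `(γ, Ψ, toFun)` (★ `exists_of_isLatticeBasis`: `Λ_r = ℤ^{2g} = Λ_{r₀}`); TWIST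
`Λ` along the similitude tower `(Γ_M, ν_M)` of `k` (★ `exists_similitudeTower`, ★ `SymplecticLift.exists_twist`): since `k ≡ 1 (mod N)`, `Γ_N = 1`
(★ `mem_principalLevelSubgroup_iff_forall_integralAdeleResidue_eq`) and the twisted lift lives on `φ·1 = φ` (★ `twist_one`); its tower read through
`r` is `m.r` again, because `r⁻¹ v̂ ≡ x̃∕M` forces `r₀⁻¹ v̂ ≡ k·x̃∕M ≡ (Γ_M x)~∕M` (★ `adelicCongr_mul_left_iff_of_mem_one`, ★
`adelicCongr_val_div_of_entries_residue`).  Now both `m♯` and `m′` are matched at `(Z, r)` — ONE index — and ★ `toFun_eq_toFun_of_lifts` (Serre's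
lemma, `N ≥ 3`) gives `m.toFun = m♯.toFun = m′.toFun`.  Deligne 4.12 (b) ∕ Milne (63): `K = GSp(ẑ)` acts on the similitude classes; the class
of `K_δ(N)` does not see the representative.

* §1 `SiegelAdelicMarking.exists_reindex_lift_of_mul_mem` — the re-indexed marking and its twisted matched lift along `k ∈ K_δ(N)`.
* §2 **`SiegelAdelicMarking.toFun_eq_toFun_of_lifts₂`** — THE HEAD (two principal representatives of one residue).

## References
* [Milne2005ShimuraVarieties] J. S. Milne, *Introduction to Shimura Varieties* (2005), §6 Thm. 6.11 pp. 74–75, (63) p. 116; §5 Lemma 5.13 p. 57.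
* [Deligne1971TravauxShimura] P. Deligne, *Travaux de Shimura*, Sém. Bourbaki 389 (1971), 4.12 (b) p. 149, Exemple 4.16 p. 150.
* [Lange2023AbelianVarietiesComplex] H. Lange, *Abelian Varieties over the Complex Numbers* (2023), §3.1.2 Prop. 3.1.4, Rem. 3.1.10 (2).
-/

set_option autoImplicit false

noncomputable section

open CategoryTheory CategoryTheory.Limits AlgebraicGeometry Matrix Topology
open scoped MonObj
open Literature.AlgebraicGeometry.Motives (SchemeOver ComplexPoints AlgPoints specOver AbelianVariety CartierDivisor)
open Literature.AlgebraicGeometry.AbelianSchemes (PolarizedAbelianSchemeWithLevel AbelianSchemeOver)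
open Literature.Geometry.Kaehler (ComplexTorus)
open Literature.NumberTheory.Automorphic (siegelUpperHalfSpace)
open Literature.NumberTheory.Adeles

namespace Literature.AlgebraicGeometry.ModuliOfAbelianVarieties

open SiegelModuli

variable {g : ℕ} {δ : Fin g → ℕ} {N : ℕ} {S : Scheme} {B : AbelianSchemeOver S} {s : Spec (CommRingCat.of ℂ) ⟶ S} {D : B.DualPair}
  {lam : B.X ⟶ D.hat.X} {φ : B.LevelStructure g N} {Θ Θ' : CartierDivisor (B.fibre s).toAbelianVariety.X.left}
  {r₀ r : gspFinAdelic δ} {Z : Matrix (Fin g) (Fin g) ℂ}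

/-! ### §1 Re-indexing along `k ∈ K_δ(N)` with a twisted matched lift -/

/-- **RE-INDEXING A MATCHED MARKING ALONG `k = r₀⁻¹ r ∈ K_δ(N)`.**  If `(m, Λ)` is matched at `(Z, r₀)` (`Λ.lift M x = m.r v` whenever
`r₀⁻¹ v̂ ≡ x̃∕M`), `m.γ = 1`, and `r = r₀ k` with `k ∈ K_δ(N)`, `r ∈ K_δ(1)`, then there are a marking `m♯` by `[J, r]` with THE SAME torus map and
torsion parametrisation, `m♯.γ = 1`, and a symplectic lift `Λ♯` of `(φ, Θ)` matched with `m♯` at `(Z, r)` — `Λ♯ = Λ ∘ Γ` for the similitude tower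
`Γ` of `k`, which lives on `φ·Γ_N = φ·1 = φ`. [cite: Deligne1971TravauxShimura, 4.12 (b) p. 149 and 4.16 p. 150] [cite: Milne2005ShimuraVarieties, §6 (63) and p. 75] -/
theorem SiegelAdelicMarking.exists_reindex_lift_of_mul_mem [IsCommMonObj B.X] [NeZero N] (hg : 0 < g) (hδ : IsPolarizationType δ)
    {J : C0pm δ} (hr : r ∈ principalLevelSubgroup δ 1) {k : gspFinAdelic δ} (hk : k ∈ principalLevelSubgroup δ N) (hrk : r = r₀ * k)
    (m : SiegelAdelicMarking J r₀ (B.fibre s).toAbelianVariety) (hγ : m.γ = 1) (Λ : φ.SymplecticLift s Θ δ)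
    (hΛ : ∀ ⦃M : ℕ⦄, N ∣ M → M ≠ 0 → ∀ (x : Fin g ⊕ Fin g → ZMod M) (v : Fin g ⊕ Fin g → ℚ),
      AdelicCongr ((r₀⁻¹ : gspFinAdelic δ) : GL (Fin g ⊕ Fin g) finAdeleQ) 1 v (fun i => ((x i).val : ℚ) / M) →
        ((Λ.lift M (Multiplicative.ofAdd x)) : (B.fibre s).toAbelianVariety.Points ℂ) = m.r v) :
    ∃ (m' : SiegelAdelicMarking J r (B.fibre s).toAbelianVariety) (Λ' : φ.SymplecticLift s Θ δ),
      m'.γ = 1 ∧ m'.Ψ = m.Ψ ∧ (∀ t, m'.toFun t = m.toFun t) ∧ (∀ v, m'.r v = m.r v) ∧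
      ∀ ⦃M : ℕ⦄, N ∣ M → M ≠ 0 → ∀ (x : Fin g ⊕ Fin g → ZMod M) (v : Fin g ⊕ Fin g → ℚ),
        AdelicCongr ((r⁻¹ : gspFinAdelic δ) : GL (Fin g ⊕ Fin g) finAdeleQ) 1 v (fun i => ((x i).val : ℚ) / M) →
          ((Λ'.lift M (Multiplicative.ofAdd x)) : (B.fibre s).toAbelianVariety.Points ℂ) = m'.r v := by
  classical
  -- the re-indexed marking: `Λ_r = ℤ^{2g} = γ ℤ^{2g}` for `γ = 1`
  obtain ⟨m', hγ', hΨ', htoFun', hr'⟩ :=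
    m.exists_of_isLatticeBasis (a' := r) (hγ ▸ isLatticeBasis_one_of_mem_principalLevelSubgroup_one hr)
  -- the similitude tower of `k`; `Γ_N = 1` since `k ∈ K_δ(N)`
  have hk1 : k ∈ principalLevelSubgroup δ 1 := principalLevelSubgroup_anti δ (one_dvd N) hk
  obtain ⟨Γ, ν, hΓres, hΓcompat, hνcompat, hΓsim⟩ := exists_similitudeTower δ hδ hg hk1
  have hΓN : Γ N = 1 := by
    ext i j
    rw [hΓres N i j (isIntegral_of_isCongOne_one ((mem_principalLevelSubgroup_iff δ).1 hk1).1 i j), Units.val_one]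
    exact (mem_principalLevelSubgroup_iff_forall_integralAdeleResidue_eq (N := N) δ hk1).1 hk i j
  -- the twisted lift, on `φ·Γ_N = φ`
  have key : ∃ Λ' : (φ.twist (Γ N)).SymplecticLift s Θ δ, ∀ (M : ℕ) (x : Fin g ⊕ Fin g → ZMod M),
      ((Λ'.lift M (Multiplicative.ofAdd x)) : (B.fibre s).toAbelianVariety.Points ℂ) =
        Λ.lift M (Multiplicative.ofAdd ((Γ M : Matrix (Fin g ⊕ Fin g) (Fin g ⊕ Fin g) (ZMod M)) *ᵥ x)) :=
    Λ.exists_twist Γ ν (fun M k' hNM hM hk' i j => hΓcompat k' hM hk' i j) (fun M k' hNM hM hk' => hνcompat k' hM hk')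
      (fun M hNM hM x y => hΓsim hM x y)
  rw [hΓN, AbelianSchemeOver.LevelStructure.twist_one] at key
  obtain ⟨Λ', hΛ'⟩ := key
  refine ⟨m', Λ', hγ'.trans hγ, hΨ', fun t => ?_, hr', fun M hNM hM x v hv => ?_⟩
  · exact congrFun (eq_of_heq htoFun') t
  · -- `r⁻¹ v̂ ≡ x̃/M` ⟹ `r₀⁻¹ v̂ ≡ k x̃/M ≡ (Γ_M x)~/M`
    haveI : NeZero M := ⟨hM⟩
    have hr₀ : ((r₀⁻¹ : gspFinAdelic δ) : GL (Fin g ⊕ Fin g) finAdeleQ) =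
        ((k : gspFinAdelic δ) : GL (Fin g ⊕ Fin g) finAdeleQ) * ((r⁻¹ : gspFinAdelic δ) : GL (Fin g ⊕ Fin g) finAdeleQ) := by
      rw [hrk, _root_.mul_inv_rev, ← Subgroup.coe_mul, ← mul_assoc, mul_inv_cancel, one_mul]
    have h1 : AdelicCongr ((r₀⁻¹ : gspFinAdelic δ) : GL (Fin g ⊕ Fin g) finAdeleQ)
        ((k : gspFinAdelic δ) : GL (Fin g ⊕ Fin g) finAdeleQ) v (fun i => ((x i).val : ℚ) / M) := by
      have h := (adelicCongr_mul_left_iff_of_mem_one hk1 ((r⁻¹ : gspFinAdelic δ) : GL (Fin g ⊕ Fin g) finAdeleQ) 1 v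
        (fun i => ((x i).val : ℚ) / M)).2 hv
      rwa [mul_one, ← hr₀] at h
    have h2 := adelicCongr_val_div_of_entries_residue hk1 (Γ M : Matrix (Fin g ⊕ Fin g) (Fin g ⊕ Fin g) (ZMod M)) (hΓres M) x
    rw [hΛ', hr']
    exact hΛ hNM hM _ v (h1.trans h2)

/-! ### §2 THE HEAD: two principal representatives of one residue -/

/-- **FLAT-d — TWO ADMISSIBLE MARKINGS OF ONE FIBRE AT `(Z, r₀)` AND `(Z, r)` FOR TWO PRINCIPAL REPRESENTATIVES OF ONE RESIDUE HAVE THE SAME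
TORUS MAP.**  `r₀ = diag(1, u₀·1)`, `r = diag(1, u·1)` with `u₀, u` `ẑ`-units `≡ c (mod N)` (the (U3) binder blocks of ★ P-3, token for token);
`(m, Θ, Λ)` matched at `(Z, r₀)` and `(m′, Θ′, Λ′)` at `(Z, r)` (ample `IsLambdaOfAt` witnesses `Θ, Θ′` of one `λ`), both with unit lattice frame.
Then `m.toFun = m′.toFun` on `(ℝ∕ℤ)^{2g}`: `k := r₀⁻¹ r ∈ K_δ(N)` (★ `inv_mul_mem_principalLevelSubgroup_of_principalRep`), §1 re-indexes `(m, Λ)` to a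
pair matched at `(Z, r)` with the same torus map, and MRK-UNIQ ★ `toFun_eq_toFun_of_lifts` (one index; lemma of Serre, `N ≥ 3`) concludes.  USE
(`stub_FLAT` adapter): the ADM-NF marking at `(φT t₀, s t₀)` for every `(u, r)` has the torus map of the one used by ★ NORM₀, so its chart junction
`hjunc₀` holds and ★ FLAT-c fires at every `(t, u, r)`.
[cite: Milne2005ShimuraVarieties, §6 Thm. 6.11 pp. 74–75, (63) p. 116; Lemma 5.13 p. 57] [cite: Deligne1971TravauxShimura, 4.12 (b) p. 149 and 4.16 p. 150]
[cite: Lange2023AbelianVarietiesComplex, §3.1.2 Prop. 3.1.4, §3.1.3 Remark 3.1.10 (2)] -/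
theorem SiegelAdelicMarking.toFun_eq_toFun_of_lifts₂ [IsCommMonObj B.X] (hg : 0 < g) (hδ : IsPolarizationType δ) (hN : 3 ≤ N)
    {c : (ZMod N)ˣ} {u₀ u : finAdeleQˣ}
    (h₀₁ : ∀ v, Valued.v ((u₀ : finAdeleQ) v) = 1) (h₀₂ : (u₀ : finAdeleQ) - ((c : ZMod N).val : ℕ) ∈ levelIdeal N)
    (_h₀₃ : r₀ ∈ principalLevelSubgroup δ 1) (_h₀₄ : IsMultiplier (typeFormOver δ finAdeleQ) (r₀ : GL (Fin g ⊕ Fin g) finAdeleQ) u₀)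
    (h₀₅ : ((r₀ : GL (Fin g ⊕ Fin g) finAdeleQ) : Matrix (Fin g ⊕ Fin g) (Fin g ⊕ Fin g) finAdeleQ) =
      Matrix.fromBlocks 1 0 0 ((u₀ : finAdeleQ) • (1 : Matrix (Fin g) (Fin g) finAdeleQ)))
    (h₁ : ∀ v, Valued.v ((u : finAdeleQ) v) = 1) (h₂ : (u : finAdeleQ) - ((c : ZMod N).val : ℕ) ∈ levelIdeal N)
    (h₃ : r ∈ principalLevelSubgroup δ 1) (_h₄ : IsMultiplier (typeFormOver δ finAdeleQ) (r : GL (Fin g ⊕ Fin g) finAdeleQ) u)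
    (h₅ : ((r : GL (Fin g ⊕ Fin g) finAdeleQ) : Matrix (Fin g ⊕ Fin g) (Fin g ⊕ Fin g) finAdeleQ) =
      Matrix.fromBlocks 1 0 0 ((u : finAdeleQ) • (1 : Matrix (Fin g) (Fin g) finAdeleQ)))
    (hZ : Z ∈ siegelUpperHalfSpace g)
    (m : SiegelAdelicMarking ⟨jOfSiegel δ Z, SiegelComplexRecordSystem.jOfSiegel_mem_C0pm hδ.1 hZ⟩ r₀ (B.fibre s).toAbelianVariety)
    (Λ : φ.SymplecticLift s Θ δ) (hΘl : B.IsLambdaOfAt s D lam Θ)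
    (hΛ : ∀ ⦃M : ℕ⦄, N ∣ M → M ≠ 0 → ∀ (x : Fin g ⊕ Fin g → ZMod M) (v : Fin g ⊕ Fin g → ℚ),
      AdelicCongr ((r₀⁻¹ : gspFinAdelic δ) : GL (Fin g ⊕ Fin g) finAdeleQ) 1 v (fun i => ((x i).val : ℚ) / M) →
        ((Λ.lift M (Multiplicative.ofAdd x)) : (B.fibre s).toAbelianVariety.Points ℂ) = m.r v)
    (m' : SiegelAdelicMarking ⟨jOfSiegel δ Z, SiegelComplexRecordSystem.jOfSiegel_mem_C0pm hδ.1 hZ⟩ r (B.fibre s).toAbelianVariety)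
    (Λ' : φ.SymplecticLift s Θ' δ) (hΘl' : B.IsLambdaOfAt s D lam Θ')
    (hΛ' : ∀ ⦃M : ℕ⦄, N ∣ M → M ≠ 0 → ∀ (x : Fin g ⊕ Fin g → ZMod M) (v : Fin g ⊕ Fin g → ℚ),
      AdelicCongr ((r⁻¹ : gspFinAdelic δ) : GL (Fin g ⊕ Fin g) finAdeleQ) 1 v (fun i => ((x i).val : ℚ) / M) →
        ((Λ'.lift M (Multiplicative.ofAdd x)) : (B.fibre s).toAbelianVariety.Points ℂ) = m'.r v)
    (hγ : m.γ = 1) (hγ' : m'.γ = 1) (t : ComplexTorus m.Ψ) : m.toFun t = m'.toFun t := by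
  haveI : NeZero N := ⟨by omega⟩
  -- `k := r₀⁻¹ r ∈ K_δ(N)`, `r = r₀ k`
  have hk : r₀⁻¹ * r ∈ principalLevelSubgroup δ N :=
    inv_mul_mem_principalLevelSubgroup_of_principalRep h₀₁ h₀₂ h₀₅ h₁ h₂ h₅
  have hrk : r = r₀ * (r₀⁻¹ * r) := (mul_inv_cancel_left r₀ r).symm
  -- re-index `(m, Λ)` to `(Z, r)` keeping the torus map
  obtain ⟨m₁, Λ₁, hγ₁, -, htoFun₁, -, hΛ₁⟩ :=
    SiegelAdelicMarking.exists_reindex_lift_of_mul_mem (φ := φ) (Θ := Θ) hg hδ h₃ hk hrk m hγ Λ hΛ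
  -- MRK-UNIQ at the single index `r`
  rw [← htoFun₁ t]
  exact SiegelAdelicMarking.toFun_eq_toFun_of_lifts hg hδ hN h₃ hZ m₁ Λ₁ hΘl hΛ₁ m' Λ' hΘl' hΛ' (hγ₁.trans hγ'.symm) t

end Literature.AlgebraicGeometry.ModuliOfAbelianVarieties

end
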